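import Summits.Ventures.CertifiedManyBodySolver.Downfold.BoxesLa214V115M2bBoxReadRoute
import Literature.MathematicalPhysics.QuantumLattice.HubbardOneSpinDiagHopKinematicRow
import HarnessLib

/-!
# Ventures/CertifiedManyBodySolver — Downfold/BoxesLa214V115M2bBoxReadExt.lean: the bundle row WITH ONE EXTRA STATE PREMISE (the «T′-BOX» /
# «DOCC-BOX» `--ext` editions of a boxdual read), its orbit-lower family, and the K2 closer from the overhang row in that shape

HONEST FRAMING: typing only. A boxdual light read run with `--ext <letter>:lo:hi` certifies its uniform floor `F` for the (pseudo-)states whose named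
moment letters lie in the declared ranges; for TRUE states that range must be a THEOREM about the states quantified (captain RULING «T′-BOX FOR LA214»
hubbard-obs STATUS 2026-08-28T12:54:36Z (3)(β): «ONE extra premise "per-spin diagonal-bond correlator ≤ 1/π on the states quantified" discharged BY NAME»;
algo-p2 READER-SOURCE ANSWER 12:53:08Z (b): «validity on the set read is ASSERTED by the caller ⇒ the range must be a program row or a typed hypothesis of
the node for the states quantified»). This file gives that hypothesis a SLOT: the row / bundle shapes below carry an arbitrary state predicate
`P : InfVolFermionState 2 → Prop` as an extra premise, and every reading discharges it by a hypothesis `hP` (to be instantiated by the typed one-body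
lemma of record — e.g. the per-spin diagonal-bond bathtub `|g_σ| ≤ sin(πn/2)/π`, hubbard-cov-hg1201-unc-3 — or, for `U`-cells, the GS docc ceiling
`docc_le_secant_of_meanEnergy_le`). With `P := fun _ => True` the shapes reduce to `SquareTTPrimeCorrOrbitLowerRow` / `TPrimeBundleOrbitLowerRow`
(§1 `…_of_row`). One-sided stiffness-scale CEILINGS on a downfolded one-band box = CONTROL / CALIBRATION (wording class (xx1)); conditional BY NAME on
claim nodes; never «certified true negative»; no `T_c`, no phase sentence; no number of record; no summit statement is proved by this seat.

Cell `pub/hubbard-downfold` × `pub/hubbard-obs` (D-0154 (1)(C) La214), seat hubbard-cov-la214-unc-2 (the captain's «…BoxReadExtDiag» typing: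
RULING «T′-BOX FOR LA214» 12:54:36Z (3)(β), then «TWO DISCHARGE TIERS W / K» 13:20:31Z «GO: PROPOSE NOW — edition K of K2 wants the --ext letter boxes,
their premise discharged by a KERNEL theorem ⇒ the Ext slot adds NO node» and «EDITION-K K2 = (K-α) two half-overhang pinned pairs» 13:40:49Z: the
edition-K node typists emit `TPrimeBundleOrbitLowerRowExt (fun _ => diagLetterBoxAt (2027/10000)) …` with the KERNEL-window floors/cap, and
`TPrimeBundleOrbitLowerRow_of_extDiag` hands the plain generic-window row to hubbard-obs-p2's `…_of_kernelWindow_split` closers). ZERO compute.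

* §1 `SquareTTPrimeCorrOrbitLowerRowExt P …` (row with premise `P ω`), `TPrimeBundleOrbitLowerRowExt P …` (bundle shape), `.orbitLower` (floor + cap +
  `hP` discharged ⇒ the SAME unconditional orbit-lower family every apex-transport closer consumes), `…_of_row` (the plain shapes are the `P`-free case);
* §2 `laBoxE_transportShadow_stiffnessLeaf_of_overhangFamily` — the K2 shadow engine stated on the FAMILY (node-free apart from its inputs);
* §4 the T′-BOX INSTANCE: `diagLetterBoxAt d ω` (|v_σ| ≤ d, both spins), its discharge from hubbard-cov-hg1201-unc-3's
  `IsTorusLimitOf.abs_oneSpinDiagBondLetter_le` for every `d ≥ 2027/10000`, and **`covLa214M2b_TransportFanCeiling_of_overhangBundleRowExtDiag (d Fo) (hd) (hbar)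
  (hO : Ext row) (nodes)`** — K2 from the T′-BOX read with NO open hypothesis beyond the claim nodes; `TPrimeBundleOrbitLowerRow_of_extDiag` (any T′-BOX Ext row IS a plain row);
* §3 `laBoxE_transportShadow_stiffnessLeaf_of_overhangBundleRowExt` / **`covLa214M2b_TransportFanCeiling_of_overhangBundleRowExt`** — K2
  (stmt-Ventures-26184) ⇐ ONE overhang corner-objective row in the Ext shape (value `Fo`, `−Fo ≤ 4364687/10⁷`) + the discharge `hP` of its premise on the
  station classes `(s, 29/5, 1)`, `s ∈ [−357/740, −3/10]` + the A₁/A₂/window nodes BY NAME.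

References: T. Koma, H. Tasaki, J. Stat. Phys. 76 (1994) 745, §1 [KomaTasaki1994]; S. Boyd, L. Vandenberghe, *Convex Optimization* (2004) §5.9
[BoydVandenberghe2004]; D. J. Scalapino, S. R. White, S.-C. Zhang, PRB 47 (1993) 7995, §II [ScalapinoWhiteZhang1993].
-/

noncomputable section

namespace Summit.Ventures.CertifiedManyBodySolver.Downfold

open Summit.Ventures.CertifiedManyBodySolver.Observables
open Summit.Ventures.CertifiedManyBodySolver.Certificates
open Literature.MathematicalPhysics.QuantumLattice Literature.MathematicalPhysics.QuantumLattice.ThermodynamicLimit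
open Literature.Probability.LatticeModels
open Matrix Filter Topology HubbardWave0
open scoped BigOperators ComplexOrder

/-! ## §1 Row and bundle shapes with ONE extra state premise -/

/-- **`D₄`-orbit-mean LOWER row with an extra state premise `P`** (the `--ext` edition of `SquareTTPrimeCorrOrbitLowerRow`): for every torus limit `ω` of
unit `(rectN n L, S^z = 0)`-sector ground states of `hubbardTorusTT' L 1 tp U`, GIVEN `e(1, tp, U, n) ≤ u` AND `P ω`, `r ≤ |S|⁻¹ Σ_γ Re ω_γ(Γ_γ X)`.
[cite: BoydVandenberghe2004, §5.9] -/
def SquareTTPrimeCorrOrbitLowerRowExt (P : InfVolFermionState 2 → Prop) (tp U n : ℝ) (u r : ℚ) (S : Finset (DihedralGroup 4))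
    (Λ : Finset (Site 2)) (X : FermionOp Λ) : Prop :=
  ∀ (ω : InfVolFermionState 2) (Ls : ℕ → ℕ) (ψ : ∀ L, Fock (Orb (FermionTorus 2 L))),
    Tendsto Ls atTop atTop →
    (∀ j, IsGroundStateInSector (hubbardTorusTT' (Ls j) 1 tp U) (rectN n (Ls j)) 0 (ψ (Ls j))) →
    (∀ j, star (ψ (Ls j)) ⬝ᵥ ψ (Ls j) = 1) → ω.IsTorusLimitOf ψ Ls →
    energyDensityTT' 1 tp U n ≤ ((u : ℚ) : ℝ) → P ω →
    ((r : ℚ) : ℝ) ≤ (S.card : ℝ)⁻¹ *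
      ∑ g ∈ S, (ω.expect (d4ShiftSet g 0 Λ) (fermionEmbed (PolySite.d4Emb g 0 Λ) X)).re

/-- The plain row is the Ext row with any premise (in particular the trivial one). [cite: BoydVandenberghe2004, §5.9] -/
theorem SquareTTPrimeCorrOrbitLowerRowExt_of_row {P : InfVolFermionState 2 → Prop} {tp U n : ℝ} {u r : ℚ} {S : Finset (DihedralGroup 4)}
    {Λ : Finset (Site 2)} {X : FermionOp Λ} (h : SquareTTPrimeCorrOrbitLowerRow tp U n u r S Λ X) :
    SquareTTPrimeCorrOrbitLowerRowExt P tp U n u r S Λ X :=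
  fun ω Ls ψ hLs hψ h1 hω hu _ => h ω Ls ψ hLs hψ h1 hω hu

/-- Conversely, an Ext row whose premise holds on the whole class is a plain row. [cite: BoydVandenberghe2004, §5.9] -/
theorem SquareTTPrimeCorrOrbitLowerRowExt.row_of_forall {P : InfVolFermionState 2 → Prop} {tp U n : ℝ} {u r : ℚ} {S : Finset (DihedralGroup 4)}
    {Λ : Finset (Site 2)} {X : FermionOp Λ} (h : SquareTTPrimeCorrOrbitLowerRowExt P tp U n u r S Λ X)
    (hP : ∀ (ω : InfVolFermionState 2) (Ls : ℕ → ℕ) (ψ : ∀ L, Fock (Orb (FermionTorus 2 L))),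
      Tendsto Ls atTop atTop →
      (∀ j, IsGroundStateInSector (hubbardTorusTT' (Ls j) 1 tp U) (rectN n (Ls j)) 0 (ψ (Ls j))) →
      (∀ j, star (ψ (Ls j)) ⬝ᵥ ψ (Ls j) = 1) → ω.IsTorusLimitOf ψ Ls → P ω) :
    SquareTTPrimeCorrOrbitLowerRow tp U n u r S Λ X :=
  fun ω Ls ψ hLs hψ h1 hω hu => h ω Ls ψ hLs hψ h1 hω hu (hP ω Ls ψ hLs hψ h1 hω)

/-- **BUNDLE ROW SHAPE WITH ONE EXTRA PREMISE** `TPrimeBundleOrbitLowerRowExt P U n s₁ s₂ f₁ f₂ u F X`: what a `boxdual/0 --ext` light read of a two-vertex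
`t′`-bundle certifies — for every `s ∈ [s₁, s₂]`, GIVEN the declared chord floor at `s`, the Ext row (cap `u`, premise `P s`) with the uniform value `F`.
[cite: BoydVandenberghe2004, §5.9] -/
def TPrimeBundleOrbitLowerRowExt (P : ℝ → InfVolFermionState 2 → Prop) (U n s₁ s₂ : ℝ) (f₁ f₂ u F : ℚ)
    (X : ℝ → FermionOp (Literature.Probability.LatticeModels.box 2 7)) : Prop :=
  ∀ s ∈ Set.Icc s₁ s₂, bundleChordFloor s₁ s₂ f₁ f₂ s ≤ energyDensityTT' 1 s U n →
    SquareTTPrimeCorrOrbitLowerRowExt (P s) s U n u F Finset.univ (Literature.Probability.LatticeModels.box 2 7) (X s)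

/-- The plain bundle shape is the Ext shape (any premise). [cite: BoydVandenberghe2004, §5.9] -/
theorem TPrimeBundleOrbitLowerRowExt_of_row {P : ℝ → InfVolFermionState 2 → Prop} {U n s₁ s₂ : ℝ} {f₁ f₂ u F : ℚ}
    {X : ℝ → FermionOp (Literature.Probability.LatticeModels.box 2 7)} (h : TPrimeBundleOrbitLowerRow U n s₁ s₂ f₁ f₂ u F X) :
    TPrimeBundleOrbitLowerRowExt P U n s₁ s₂ f₁ f₂ u F X :=
  fun s hs hfl => SquareTTPrimeCorrOrbitLowerRowExt_of_row (h s hs hfl)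

/-- **EXT SHAPE ⇒ ORBIT-LOWER FAMILY.** Once the declared floor, the cap AND the extra premise are DISCHARGED on the segment (theorems by name), the Ext bundle
row gives the unconditional family `F ≤ |D₄|⁻¹ Σ_γ Re ω_γ(Γ_γ (X s))` on the torus-limit ground-state classes at `(s, U, n)`, `s ∈ [s₁, s₂]` — the hypothesis
shape of every apex-transport closer. [cite: KomaTasaki1994, §1] -/
theorem TPrimeBundleOrbitLowerRowExt.orbitLower {P : ℝ → InfVolFermionState 2 → Prop} {U n s₁ s₂ : ℝ} {f₁ f₂ u F : ℚ}
    {X : ℝ → FermionOp (Literature.Probability.LatticeModels.box 2 7)} (h : TPrimeBundleOrbitLowerRowExt P U n s₁ s₂ f₁ f₂ u F X)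
    (hfloor : ∀ s ∈ Set.Icc s₁ s₂, bundleChordFloor s₁ s₂ f₁ f₂ s ≤ energyDensityTT' 1 s U n)
    (hcap : ∀ s ∈ Set.Icc s₁ s₂, energyDensityTT' 1 s U n ≤ ((u : ℚ) : ℝ))
    (hP : ∀ s ∈ Set.Icc s₁ s₂, ∀ (ω : InfVolFermionState 2) (Ls : ℕ → ℕ) (ψ : ∀ L, Fock (Orb (FermionTorus 2 L))),
      Tendsto Ls atTop atTop →
      (∀ j, IsGroundStateInSector (hubbardTorusTT' (Ls j) 1 s U) (rectN n (Ls j)) 0 (ψ (Ls j))) →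
      (∀ j, star (ψ (Ls j)) ⬝ᵥ ψ (Ls j) = 1) → ω.IsTorusLimitOf ψ Ls → P s ω) :
    ∀ s ∈ Set.Icc s₁ s₂, ∀ (ω : InfVolFermionState 2) (Ls : ℕ → ℕ) (ψ : ∀ L, Fock (Orb (FermionTorus 2 L))),
      Tendsto Ls atTop atTop →
      (∀ j, IsGroundStateInSector (hubbardTorusTT' (Ls j) 1 s U) (rectN n (Ls j)) 0 (ψ (Ls j))) →
      (∀ j, star (ψ (Ls j)) ⬝ᵥ ψ (Ls j) = 1) → ω.IsTorusLimitOf ψ Ls →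
      ((F : ℚ) : ℝ) ≤ ((Finset.univ : Finset (DihedralGroup 4)).card : ℝ)⁻¹ * ∑ g ∈ (Finset.univ : Finset (DihedralGroup 4)),
        (ω.expect (d4ShiftSet g 0 (Literature.Probability.LatticeModels.box 2 7))
          (fermionEmbed (PolySite.d4Emb g 0 (Literature.Probability.LatticeModels.box 2 7)) (X s))).re :=
  fun s hs ω Ls ψ hLs hψ h1 hω => h s hs (hfloor s hs) ω Ls ψ hLs hψ h1 hω (hcap s hs) (hP s hs ω Ls ψ hLs hψ h1 hω)

/-- An Ext bundle row whose premise is discharged on every class of the segment IS a plain bundle row (so every plain closer applies verbatim).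
[cite: BoydVandenberghe2004, §5.9] -/
theorem TPrimeBundleOrbitLowerRowExt.row_of_forall {P : ℝ → InfVolFermionState 2 → Prop} {U n s₁ s₂ : ℝ} {f₁ f₂ u F : ℚ}
    {X : ℝ → FermionOp (Literature.Probability.LatticeModels.box 2 7)} (h : TPrimeBundleOrbitLowerRowExt P U n s₁ s₂ f₁ f₂ u F X)
    (hP : ∀ s ∈ Set.Icc s₁ s₂, ∀ (ω : InfVolFermionState 2) (Ls : ℕ → ℕ) (ψ : ∀ L, Fock (Orb (FermionTorus 2 L))),
      Tendsto Ls atTop atTop →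
      (∀ j, IsGroundStateInSector (hubbardTorusTT' (Ls j) 1 s U) (rectN n (Ls j)) 0 (ψ (Ls j))) →
      (∀ j, star (ψ (Ls j)) ⬝ᵥ ψ (Ls j) = 1) → ω.IsTorusLimitOf ψ Ls → P s ω) :
    TPrimeBundleOrbitLowerRow U n s₁ s₂ f₁ f₂ u F X :=
  fun s hs hfl => (h s hs hfl).row_of_forall (hP s hs)

/-! ## §2 The K2 shadow engine on the FAMILY -/

/-- **K2 transport shadow from an overhang orbit-lower FAMILY** (node-free given its input): if for every source `s ∈ [−357/740, −3/10]` the corner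
objective `−X₀(−3/10, 29/5)` has the orbit-lower value `Fo` on the torus-limit ground-state class at `(s, 29/5, 1)`, then `ObsStiffnessSeqCeilingAt t′ U 1 c`
for every box target with `t′(2 − (29/5)/U) ≤ −3/10` and every `c ≥ −Fo` (slot engine, `σ = −3/10`). [cite: KomaTasaki1994, §1] [cite: ScalapinoWhiteZhang1993, §II] -/
theorem laBoxE_transportShadow_stiffnessLeaf_of_overhangFamily (Fo c : ℚ) (hco : -Fo ≤ c)
    (hfam : ∀ s ∈ Set.Icc (-(357 / 740) : ℝ) (-3 / 10), ∀ (ω : InfVolFermionState 2) (Ls : ℕ → ℕ)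
      (ψ : ∀ L, Fock (Orb (FermionTorus 2 L))),
      Tendsto Ls atTop atTop →
      (∀ j, IsGroundStateInSector (hubbardTorusTT' (Ls j) 1 s (29 / 5)) (rectN 1 (Ls j)) 0 (ψ (Ls j))) →
      (∀ j, star (ψ (Ls j)) ⬝ᵥ ψ (Ls j) = 1) → ω.IsTorusLimitOf ψ Ls →
      ((Fo : ℚ) : ℝ) ≤ ((Finset.univ : Finset (DihedralGroup 4)).card : ℝ)⁻¹ * ∑ g ∈ (Finset.univ : Finset (DihedralGroup 4)),
        (ω.expect (d4ShiftSet g 0 (Literature.Probability.LatticeModels.box 2 7))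
          (fermionEmbed (PolySite.d4Emb g 0 (Literature.Probability.LatticeModels.box 2 7)) (-oddMomentObsTT (-3 / 10) (29 / 5) 0))).re) :
    ∀ tp ∈ Set.Icc (-3 / 10 : ℝ) (-1 / 5), ∀ U ∈ Set.Icc (29 / 5 : ℝ) (74 / 5),
      tp * (2 - 29 / 5 / U) ≤ -3 / 10 → ObsStiffnessSeqCeilingAt tp U 1 c := by
  intro tp htp U hU hsrc
  have hco' : -((Fo : ℚ) : ℝ) ≤ ((c : ℚ) : ℝ) := by exact_mod_cast hco
  obtain ⟨-, e₂⟩ := laBoxE_apexSource29o5_eq (tp := tp) hU.1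
  have hlo := (laBoxE_apexSource29o5_mem htp hU).1
  set s : ℝ := tp * (2 - 29 / 5 / U) with hs
  have hsneg : s < 0 := by linarith
  have hs0 : s ≠ 0 := hsneg.ne
  have hsmem : s ∈ Set.Icc (-(357 / 740) : ℝ) (-3 / 10) := ⟨hlo, hsrc⟩
  have hslot : 2 * (-3 / 10 : ℝ) - 2 * tp = (2 * (-3 / 10) - 2 * tp) / s * s := by rw [div_mul_cancel₀ _ hs0]
  exact ObsStiffnessSeqCeilingAt_halfFilling_of_apexSource_orbitLower_slot (t'A := s) (UA := 29 / 5) (-3 / 10) (29 / 5)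
    ((Fo : ℚ) : ℝ) (by norm_num) hU.1 (by linarith [hU.1]) e₂ (hfam s hsmem)
    (div_nonneg_of_nonpos (by linarith [htp.1]) hsneg.le) hslot c hco'

/-! ## §3 K2 from the overhang row in the Ext shape -/

/-- **K2 shadow from the OVERHANG row IN THE EXT SHAPE** (value `Fo`, corner objective `−X₀(−3/10)`, premise `P s` discharged by `hP` on every station class of
the segment; floor/cap discharged BY NAME from the A₁/A₂/window nodes): `ObsStiffnessSeqCeilingAt t′ U 1 c` on the whole K2 shadow for every `c ≥ −Fo`.
[cite: KomaTasaki1994, §1] [cite: ScalapinoWhiteZhang1993, §II] -/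
theorem laBoxE_transportShadow_stiffnessLeaf_of_overhangBundleRowExt (P : ℝ → InfVolFermionState 2 → Prop) (Fo c : ℚ) (hco : -Fo ≤ c)
    (hO : TPrimeBundleOrbitLowerRowExt P (29 / 5) 1 (-(357 / 740)) (-3 / 10) laBoxE_f357o740 laBoxE_f3o10 laBoxE_HI29 Fo
      (fun _ => -oddMomentObsTT (-3 / 10) (29 / 5) 0))
    (hP : ∀ s ∈ Set.Icc (-(357 / 740) : ℝ) (-3 / 10), ∀ (ω : InfVolFermionState 2) (Ls : ℕ → ℕ) (ψ : ∀ L, Fock (Orb (FermionTorus 2 L))),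
      Tendsto Ls atTop atTop →
      (∀ j, IsGroundStateInSector (hubbardTorusTT' (Ls j) 1 s (29 / 5)) (rectN 1 (Ls j)) 0 (ψ (Ls j))) →
      (∀ j, star (ψ (Ls j)) ⬝ᵥ ψ (Ls j) = 1) → ω.IsTorusLimitOf ψ Ls → P s ω)
    (hA1 : cert_laBoxE_K2diag_GU29o5n1tpm357o740_j295983_up) (hA2 : cert_laBoxE_K2diag_GU29o5n1tpm3o10_j295889_up)
    (h21 : cert_r21_luc_tl_upper_n1_U6) (h487 : cert_r487_hubSQ_hanK7R6_U10_r5_e4_so4blk)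
    (h427 : cert_r427_hubSQ_hanK7_U5_r5_e4_so4blk) (h488 : cert_r488_hubSQ_hanK7R6_U6_r5_e4_so4blk) :
    ∀ tp ∈ Set.Icc (-3 / 10 : ℝ) (-1 / 5), ∀ U ∈ Set.Icc (29 / 5 : ℝ) (74 / 5),
      tp * (2 - 29 / 5 / U) ≤ -3 / 10 → ObsStiffnessSeqCeilingAt tp U 1 c :=
  laBoxE_transportShadow_stiffnessLeaf_of_overhangFamily Fo c hco
    (hO.orbitLower (laBoxE_overhangBundle_floor_of hA1 hA2 h21 h487 h427 h488) (fun s _ => laBoxE_u29o5_cap_of h21 h487 h427 h488 s) hP)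

/-- **K2 `TransportFanCeiling` (stmt-Ventures-26184) ⇐ the OVERHANG row in the EXT shape under the bar** (`−Fo ≤ 4364687/10⁷`) + the discharge `hP` of its
extra premise + the named nodes — the closer of the captain's rung [a-T′](β). [cite: KomaTasaki1994, §1] [cite: ScalapinoWhiteZhang1993, §II] -/
theorem covLa214M2b_TransportFanCeiling_of_overhangBundleRowExt (P : ℝ → InfVolFermionState 2 → Prop) (Fo : ℚ) (hbar : -Fo ≤ 4364687 / 10000000)
    (hO : TPrimeBundleOrbitLowerRowExt P (29 / 5) 1 (-(357 / 740)) (-3 / 10) laBoxE_f357o740 laBoxE_f3o10 laBoxE_HI29 Fo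
      (fun _ => -oddMomentObsTT (-3 / 10) (29 / 5) 0))
    (hP : ∀ s ∈ Set.Icc (-(357 / 740) : ℝ) (-3 / 10), ∀ (ω : InfVolFermionState 2) (Ls : ℕ → ℕ) (ψ : ∀ L, Fock (Orb (FermionTorus 2 L))),
      Tendsto Ls atTop atTop →
      (∀ j, IsGroundStateInSector (hubbardTorusTT' (Ls j) 1 s (29 / 5)) (rectN 1 (Ls j)) 0 (ψ (Ls j))) →
      (∀ j, star (ψ (Ls j)) ⬝ᵥ ψ (Ls j) = 1) → ω.IsTorusLimitOf ψ Ls → P s ω)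
    (hA1 : cert_laBoxE_K2diag_GU29o5n1tpm357o740_j295983_up) (hA2 : cert_laBoxE_K2diag_GU29o5n1tpm3o10_j295889_up)
    (h21 : cert_r21_luc_tl_upper_n1_U6) (h487 : cert_r487_hubSQ_hanK7R6_U10_r5_e4_so4blk)
    (h427 : cert_r427_hubSQ_hanK7_U5_r5_e4_so4blk) (h488 : cert_r488_hubSQ_hanK7R6_U6_r5_e4_so4blk) :
    Summit.Ventures.CertifiedManyBodySolver.Theses.CovLa214M2b.TransportFanCeiling :=
  laBoxE_transportShadow_stiffnessLeaf_of_overhangBundleRowExt P Fo (4364687 / 10000000) hbar hO hP hA1 hA2 h21 h487 h427 h488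

/-- **The same closer through the PLAIN closer of record**: an Ext row with its premise discharged IS a plain row, so `covLa214M2b_TransportFanCeiling_of_…`-type
closers in `…BoxReadRoute` apply verbatim (`TPrimeBundleOrbitLowerRowExt.row_of_forall`). [cite: BoydVandenberghe2004, §5.9] -/
theorem laBoxE_overhangBundleRow_of_ext (P : ℝ → InfVolFermionState 2 → Prop) (Fo : ℚ)
    (hO : TPrimeBundleOrbitLowerRowExt P (29 / 5) 1 (-(357 / 740)) (-3 / 10) laBoxE_f357o740 laBoxE_f3o10 laBoxE_HI29 Fo
      (fun _ => -oddMomentObsTT (-3 / 10) (29 / 5) 0))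
    (hP : ∀ s ∈ Set.Icc (-(357 / 740) : ℝ) (-3 / 10), ∀ (ω : InfVolFermionState 2) (Ls : ℕ → ℕ) (ψ : ∀ L, Fock (Orb (FermionTorus 2 L))),
      Tendsto Ls atTop atTop →
      (∀ j, IsGroundStateInSector (hubbardTorusTT' (Ls j) 1 s (29 / 5)) (rectN 1 (Ls j)) 0 (ψ (Ls j))) →
      (∀ j, star (ψ (Ls j)) ⬝ᵥ ψ (Ls j) = 1) → ω.IsTorusLimitOf ψ Ls → P s ω) :
    TPrimeBundleOrbitLowerRow (29 / 5) 1 (-(357 / 740)) (-3 / 10) laBoxE_f357o740 laBoxE_f3o10 laBoxE_HI29 Fo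
      (fun _ => -oddMomentObsTT (-3 / 10) (29 / 5) 0) :=
  hO.row_of_forall hP

/-! ## §4 The T′-BOX instance: the per-spin diagonal-bond LETTER BOX as the extra premise, discharged by the kinematic row of record -/

/-- **The T′-BOX letter premise at a state `ω`, half-width `d`**: both per-spin diagonal-bond letters `v_σ := Re ω(E′_σ)/4`
(`E′_σ = oneSpinDiagBondObs σ`, hubbard-cov-hg1201-unc-3's `HubbardOneSpinDiagHopKinematicRow`; reader letters v25 = `v_↑`, v116 = `v_↓` per algo-p2's
dictionary) satisfy `|v_σ| ≤ d` — what `--ext 25:−d:d --ext 116:−d:d` asserts on the states read. [cite: BoydVandenberghe2004, §5.9] -/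
def diagLetterBoxAt (d : ℚ) (ω : InfVolFermionState 2) : Prop :=
  ∀ σ : Fin 2, |(ω.expect (thicken ({0} : Finset (Site 2)) 1) (oneSpinDiagBondObs σ)).re / 4| ≤ ((d : ℚ) : ℝ)

/-- **Discharge at `d = 2027/10000`** (`2/π² < 0.2027`): every torus limit of unit vectors satisfies the letter box — filling-free, sector-free
(`IsTorusLimitOf.abs_oneSpinDiagBondLetter_le`). [cite: LiebLoss1993, §8, Theorem 8.2] -/
theorem diagLetterBoxAt_2027_of_isTorusLimitOf {ω : InfVolFermionState 2} {ψ : ∀ L, Fock (Orb (FermionTorus 2 L))} {Ls : ℕ → ℕ}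
    (h : ω.IsTorusLimitOf ψ Ls) (hLs : Tendsto Ls atTop atTop) (h1 : ∀ j, star (ψ (Ls j)) ⬝ᵥ ψ (Ls j) = 1) :
    diagLetterBoxAt (2027 / 10000) ω := fun σ =>
  (h.abs_oneSpinDiagBondLetter_le hLs h1 σ).2.2.1.trans (le_of_eq (by push_cast; norm_num))

/-- **Discharge at `d = 79/250`** (the coarser `≈ 1/π`-class literal, also certified by the same row). [cite: LiebLoss1993, §8, Theorem 8.2] -/
theorem diagLetterBoxAt_79o250_of_isTorusLimitOf {ω : InfVolFermionState 2} {ψ : ∀ L, Fock (Orb (FermionTorus 2 L))} {Ls : ℕ → ℕ}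
    (h : ω.IsTorusLimitOf ψ Ls) (hLs : Tendsto Ls atTop atTop) (h1 : ∀ j, star (ψ (Ls j)) ⬝ᵥ ψ (Ls j) = 1) :
    diagLetterBoxAt (79 / 250) ω := fun σ =>
  (h.abs_oneSpinDiagBondLetter_le hLs h1 σ).2.2.2.trans (le_of_eq (by push_cast; norm_num))

/-- Monotonicity of the letter box in its half-width. [folklore] -/
theorem diagLetterBoxAt.mono {d d' : ℚ} (hdd : d ≤ d') {ω : InfVolFermionState 2} (h : diagLetterBoxAt d ω) : diagLetterBoxAt d' ω :=
  fun σ => (h σ).trans (by exact_mod_cast hdd)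

/-- **The T′-BOX premise is discharged on EVERY station class for every half-width `d ≥ 2027/10000`** (the `hP` input of §1/§3 for
`P := fun _ => diagLetterBoxAt d`). [cite: LiebLoss1993, §8, Theorem 8.2] -/
theorem diagLetterBoxAt_discharge {d : ℚ} (hd : 2027 / 10000 ≤ d) (U n s₁ s₂ : ℝ) :
    ∀ s ∈ Set.Icc s₁ s₂, ∀ (ω : InfVolFermionState 2) (Ls : ℕ → ℕ) (ψ : ∀ L, Fock (Orb (FermionTorus 2 L))),
      Tendsto Ls atTop atTop →
      (∀ j, IsGroundStateInSector (hubbardTorusTT' (Ls j) 1 s U) (rectN n (Ls j)) 0 (ψ (Ls j))) →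
      (∀ j, star (ψ (Ls j)) ⬝ᵥ ψ (Ls j) = 1) → ω.IsTorusLimitOf ψ Ls → (fun _ : ℝ => diagLetterBoxAt d) s ω :=
  fun _ _ _ _ _ hLs _ h1 hω => (diagLetterBoxAt_2027_of_isTorusLimitOf hω hLs h1).mono hd

/-- **K2 `TransportFanCeiling` (stmt-Ventures-26184) ⇐ the OVERHANG row read WITH THE T′-BOX (`--ext` half-width `d ≥ 2027/10000` on the letters v25/v116)
under the bar** + the named nodes — the extra premise is discharged INSIDE by the kinematic row of record, so the node closes K2 by ONE `exact` with NO open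
hypothesis beyond the claim nodes (captain RULING «T′-BOX FOR LA214» 2026-08-28T12:54:36Z, rung [a-T′](β)). [cite: KomaTasaki1994, §1] [cite: ScalapinoWhiteZhang1993, §II] -/
theorem covLa214M2b_TransportFanCeiling_of_overhangBundleRowExtDiag (d Fo : ℚ) (hd : 2027 / 10000 ≤ d) (hbar : -Fo ≤ 4364687 / 10000000)
    (hO : TPrimeBundleOrbitLowerRowExt (fun _ => diagLetterBoxAt d) (29 / 5) 1 (-(357 / 740)) (-3 / 10) laBoxE_f357o740 laBoxE_f3o10 laBoxE_HI29 Fo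
      (fun _ => -oddMomentObsTT (-3 / 10) (29 / 5) 0))
    (hA1 : cert_laBoxE_K2diag_GU29o5n1tpm357o740_j295983_up) (hA2 : cert_laBoxE_K2diag_GU29o5n1tpm3o10_j295889_up)
    (h21 : cert_r21_luc_tl_upper_n1_U6) (h487 : cert_r487_hubSQ_hanK7R6_U10_r5_e4_so4blk)
    (h427 : cert_r427_hubSQ_hanK7_U5_r5_e4_so4blk) (h488 : cert_r488_hubSQ_hanK7R6_U6_r5_e4_so4blk) :
    Summit.Ventures.CertifiedManyBodySolver.Theses.CovLa214M2b.TransportFanCeiling :=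
  covLa214M2b_TransportFanCeiling_of_overhangBundleRowExt (fun _ => diagLetterBoxAt d) Fo hbar hO
    (diagLetterBoxAt_discharge hd (29 / 5) 1 (-(357 / 740)) (-3 / 10)) hA1 hA2 h21 h487 h427 h488

/-- With the premise discharged, the T′-BOX overhang row IS a plain overhang row (so `covLa214M2b_TransportFanCeiling_of_overhangBundleRow` and every other
closer of `…BoxReadRoute` / `…InnerHalfOverhang` apply verbatim). [cite: BoydVandenberghe2004, §5.9] -/
theorem laBoxE_overhangBundleRow_of_extDiag (d Fo : ℚ) (hd : 2027 / 10000 ≤ d)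
    (hO : TPrimeBundleOrbitLowerRowExt (fun _ => diagLetterBoxAt d) (29 / 5) 1 (-(357 / 740)) (-3 / 10) laBoxE_f357o740 laBoxE_f3o10 laBoxE_HI29 Fo
      (fun _ => -oddMomentObsTT (-3 / 10) (29 / 5) 0)) :
    TPrimeBundleOrbitLowerRow (29 / 5) 1 (-(357 / 740)) (-3 / 10) laBoxE_f357o740 laBoxE_f3o10 laBoxE_HI29 Fo
      (fun _ => -oddMomentObsTT (-3 / 10) (29 / 5) 0) :=
  hO.row_of_forall (diagLetterBoxAt_discharge hd (29 / 5) 1 (-(357 / 740)) (-3 / 10))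

/-- **General form: ANY Ext bundle row read with the T′-BOX is a plain bundle row** (any station `U`, density `n`, segment, floors, cap, objective) —
the inner-half / near-sub-row / foot `t′`-editions inherit it. [cite: BoydVandenberghe2004, §5.9] -/
theorem TPrimeBundleOrbitLowerRow_of_extDiag {d : ℚ} (hd : 2027 / 10000 ≤ d) {U n s₁ s₂ : ℝ} {f₁ f₂ u F : ℚ}
    {X : ℝ → FermionOp (Literature.Probability.LatticeModels.box 2 7)}
    (hO : TPrimeBundleOrbitLowerRowExt (fun _ => diagLetterBoxAt d) U n s₁ s₂ f₁ f₂ u F X) :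
    TPrimeBundleOrbitLowerRow U n s₁ s₂ f₁ f₂ u F X :=
  hO.row_of_forall (diagLetterBoxAt_discharge hd U n s₁ s₂)

/-- Literals (decidable): `2027/10000 ≤ 79/250` and `2027/10000 < 1/3`; the unit-box constant `8 = 2 letters × |coeff| 4 × box 1` becomes
`8 × 2027/10000 = 2027/1250 = 1.6216` with the T′-BOX (÷ 4.93). [folklore] -/
theorem diagLetterBox_literals :
    ((2027 / 10000 : ℚ) ≤ 79 / 250) ∧ ((2027 / 10000 : ℚ) < 1 / 3) ∧ ((8 : ℚ) * (2027 / 10000) = 2027 / 1250) := by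
  norm_num

end Summit.Ventures.CertifiedManyBodySolver.Downfold

end
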